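import Summits.QuantumFields.YangMills.Theorems.VirialFluxGapRadialProfile
import Summits.QuantumFields.YangMills.Theorems.VirialFluxGapCentralLiftProximity
import HarnessLib

/-!
# Route `VirialFluxGap` (YangMills): BASE MOTION of the anchored radial profile — the chain rule through the central lift and the exact trace
# `Σ_a ∂_a Im_a(conj(lift σ z(P))·q(P_v)) = 3Re(c̄q) − N⁻¹(3q₀² + 2|p|² + σq₀(z·p)/√(1−|z|²))` along a block variable's own frame curves
# (brick (1b) of the explicit central field `X_c = X_z + U` for crux ⟨stmt-QuantumFields-24141⟩; free-hands helper)

Width seat `ym-line-sfw-p2-w3` g59 (cell ym-idea-1, free hands), `--supports stmt-QuantumFields-24141`.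

In the explicit central field of HOME memo `w3-g59-EXPLICIT-CENTRAL-FIELD-24141.md` the anchor of a wrap-block ∕ seam variable `v ∈ B` is the central lift
`c_B(P) = liftQuat σ_B z_B(P)` of the block AVERAGE `z_B` (✓`blockIm`, ✓`seamIm`), so along the own frame curve of `v` in the unit direction `u_a` the anchor
moves too: `ż_B = N_B⁻¹·Im(q_v·u_a)`.  ✓`VirialFluxGapAnchoredProfile` computed the frozen-anchor part (`3·Re(c̄q)` per variable); this file adds the moving part:

* §1 ★★ `base_motion_trace` — the pure quaternion identity: with `w_a = N⁻¹·Im(q·u_a)` and `D_a = (−σ(z·w_a)/r, w_a)` (the derivative of the lift, `r = √(1−|z|²)`),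
  `Σ_a Im_a(conj(D_a)·q) = −N⁻¹·(3q₀² + 2|p|² + σ·q₀·(z·p)/r)` (`q = (q₀, p)`); for a unit `q` this is `−N⁻¹(3 − |p|² + σq₀(z·p)/r)`, i.e. `−3/N` per variable up
  to `O(|z|² + |p|²)/N`: summed over the `N` variables of a block the base motion contributes **`−3 + O(r₀² + ρ²)`** to `div U` — the projection `π_C` removes
  the three zero-mode directions of the block (`base_motion_trace_unit`, `base_motion_le`);
* §2 ★ `liftQuat_eq_smul_sum`, `hasDerivAt_liftQuat` — the chain rule through the lift: `d/ds lift σ z(s) = (−σ(z·ż)/√(1−|z|²), ż)` while `|z|² < 1`;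
* §3 ★ `hasDerivAt_im_star_mul` — product rule for `s ↦ Im_a(conj(c(s))·q(s))`;
* §4 ★★★ `hasDerivAt_anchored_own` — along a curve with `ż = N⁻¹Im(q·u_a)` and `q̇ = q·u_a` the `a`-th anchored profile has derivative
  `Im_a(c̄·q·u_a) + Im_a(conj(D_a)·q)` (frozen + base), and ★★★ `anchored_own_trace` — the sum over `a` of these derivatives is
  `3·Re(c̄q) − N⁻¹(3q₀² + 2|p|² + σq₀(z·p)/r)` EXACTLY.
The identification of the curves (`z(s) = blockIm (wrapBlock k) k (P·γ_{v,u_a}(s))`, ✓`hasDerivAt_bsliceCoeff`; `q(s) = su2Quat((P·γ s)_v)`,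
✓`hasDerivAt_su2Quat_mul_expSU`) is the standard plumbing of ✓`BlockZeroModeField` ∕ ✓`QuaternionRadialFlow` and is left to the divergence file of `U`.

HONEST LABEL: calculus ∕ quaternion bookkeeping for a RECORD-label crux of a DRAFT route; no coefficient field is assembled, neither (E1) nor (E2) is proved here;
⟨24141⟩ and ⟨22884⟩ stay OPEN; the Yang–Mills mass gap is NOT proved by this; no summit is proved by a line.  THEOREMS ONLY (no `def`, no `sorry`).

References: [cite: arXiv220412737, §2 (2.4) (p. 10)]; [cite: CosteEtAl1985].
-/

set_option autoImplicit false

noncomputable section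

open scoped Matrix BigOperators ContDiff Topology Quaternion
open Literature.MathematicalPhysics.QuantumFieldTheory hiding SU2
open Literature.MathematicalPhysics.QuantumLattice

namespace Summit.QuantumFields.YangMills.Theorems.VirialFluxGap.FrameDerivative

open Summit.QuantumFields.YangMills.Theorems.VirialFluxGap.CentralCoercivity (dot3_sq_le)

/-! ## §1 The base-motion trace: pure quaternion algebra -/

/-- The imaginary parts of `q·i`, `q·j`, `q·k` (the velocities of `Im q` along the three unit frame curves): `Im(q·u_a) = q₀e_a + p × e_a`. [folklore] -/
theorem im_mul_zUnit (q : ℍ) :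
    ((q * ⟨0, 1, 0, 0⟩).imI = q.re ∧ (q * ⟨0, 1, 0, 0⟩).imJ = q.imK ∧ (q * ⟨0, 1, 0, 0⟩).imK = -q.imJ) ∧
    ((q * ⟨0, 0, 1, 0⟩).imI = -q.imK ∧ (q * ⟨0, 0, 1, 0⟩).imJ = q.re ∧ (q * ⟨0, 0, 1, 0⟩).imK = q.imI) ∧
    ((q * ⟨0, 0, 0, 1⟩).imI = q.imJ ∧ (q * ⟨0, 0, 0, 1⟩).imJ = -q.imI ∧ (q * ⟨0, 0, 0, 1⟩).imK = q.re) := by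
  refine ⟨⟨?_, ?_, ?_⟩, ⟨?_, ?_, ?_⟩, ⟨?_, ?_, ?_⟩⟩ <;>
    simp [Quaternion.imI_mul, Quaternion.imJ_mul, Quaternion.imK_mul]

/-- ★★ **The base-motion trace.**  Let `q = (q₀, p)` be the variable's quaternion, `z` the block data, `σ` the sign, `ri` (`= 1/√(1−|z|²)`) and `Ni`
(`= 1/#block`) reals.  Along the unit frame curve `u_a` the block average moves with velocity `w_a = Ni·Im(q·u_a)` and the conjugate anchor with velocity
`E_a = conj(D lift[w_a]) = (−σ·ri·(z·w_a), −w_a)`.  Then `Σ_a Im_a(E_a·q) = −Ni·(3q₀² + 2|p|² + σ·ri·q₀·(z·p))`.  (The `E_a` are taken as variables with their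
components prescribed, so that the identity applies verbatim to the derivatives produced by the chain rule.) [cite: CosteEtAl1985] -/
theorem base_motion_trace (q E₀ E₁ E₂ : ℍ) (z : Fin 3 → ℝ) (σ ri Ni : ℝ)
    (h₀ : E₀.re = -σ * ri * (z 0 * (Ni * q.re) + z 1 * (Ni * q.imK) + z 2 * (Ni * -q.imJ)) ∧
      E₀.imI = -(Ni * q.re) ∧ E₀.imJ = -(Ni * q.imK) ∧ E₀.imK = -(Ni * -q.imJ))
    (h₁ : E₁.re = -σ * ri * (z 0 * (Ni * -q.imK) + z 1 * (Ni * q.re) + z 2 * (Ni * q.imI)) ∧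
      E₁.imI = -(Ni * -q.imK) ∧ E₁.imJ = -(Ni * q.re) ∧ E₁.imK = -(Ni * q.imI))
    (h₂ : E₂.re = -σ * ri * (z 0 * (Ni * q.imJ) + z 1 * (Ni * -q.imI) + z 2 * (Ni * q.re)) ∧
      E₂.imI = -(Ni * q.imJ) ∧ E₂.imJ = -(Ni * -q.imI) ∧ E₂.imK = -(Ni * q.re)) :
    (E₀ * q).imI + (E₁ * q).imJ + (E₂ * q).imK =
      -Ni * (3 * q.re ^ 2 + 2 * (q.imI ^ 2 + q.imJ ^ 2 + q.imK ^ 2) + σ * ri * q.re * (z 0 * q.imI + z 1 * q.imJ + z 2 * q.imK)) := by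
  obtain ⟨h₀r, h₀i, h₀j, h₀k⟩ := h₀
  obtain ⟨h₁r, h₁i, h₁j, h₁k⟩ := h₁
  obtain ⟨h₂r, h₂i, h₂j, h₂k⟩ := h₂
  simp only [Quaternion.imI_mul, Quaternion.imJ_mul, Quaternion.imK_mul, h₀r, h₀i, h₀j, h₀k, h₁r, h₁i, h₁j, h₁k, h₂r, h₂i, h₂j, h₂k]
  ring

/-- For a UNIT quaternion the base-motion trace is `−Ni·(3 − |p|² + σ·ri·q₀·(z·p))`. [cite: CosteEtAl1985] -/
theorem base_motion_trace_unit (q : ℍ) (hq : q.re ^ 2 + q.imI ^ 2 + q.imJ ^ 2 + q.imK ^ 2 = 1) (z : Fin 3 → ℝ) (σ ri Ni : ℝ) :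
    -Ni * (3 * q.re ^ 2 + 2 * (q.imI ^ 2 + q.imJ ^ 2 + q.imK ^ 2) + σ * ri * q.re * (z 0 * q.imI + z 1 * q.imJ + z 2 * q.imK)) =
      -Ni * (3 - (q.imI ^ 2 + q.imJ ^ 2 + q.imK ^ 2) + σ * ri * q.re * (z 0 * q.imI + z 1 * q.imJ + z 2 * q.imK)) := by
  have h : 3 * q.re ^ 2 + 2 * (q.imI ^ 2 + q.imJ ^ 2 + q.imK ^ 2) = 3 - (q.imI ^ 2 + q.imJ ^ 2 + q.imK ^ 2) := by nlinarith
  rw [h]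

/-- ★ **The base motion is `−3/N` up to second order**: for a unit `q = (q₀,p)`, `σ = ±1`, `0 ≤ Ni`, `|p|² ≤ ε` and `|ri|·|z|·|p| ≤ ε` (all true on the
central region with `ε = O(r₀² + ρ²)`), the base-motion trace is at most `−Ni·(3 − 2ε)`. [cite: CosteEtAl1985] -/
theorem base_motion_le (q : ℍ) (hq : q.re ^ 2 + q.imI ^ 2 + q.imJ ^ 2 + q.imK ^ 2 = 1) (z : Fin 3 → ℝ) {σ ri Ni ε : ℝ}
    (hσ : σ = 1 ∨ σ = -1) (hNi : 0 ≤ Ni) (hp : q.imI ^ 2 + q.imJ ^ 2 + q.imK ^ 2 ≤ ε)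
    (hzp : |ri| * Real.sqrt ((z 0) ^ 2 + (z 1) ^ 2 + (z 2) ^ 2) * Real.sqrt (q.imI ^ 2 + q.imJ ^ 2 + q.imK ^ 2) ≤ ε) :
    -Ni * (3 - (q.imI ^ 2 + q.imJ ^ 2 + q.imK ^ 2) + σ * ri * q.re * (z 0 * q.imI + z 1 * q.imJ + z 2 * q.imK)) ≤ -Ni * (3 - 2 * ε) := by
  -- `|σ ri q₀ (z·p)| ≤ |ri|·|z|·|p| ≤ ε` (Cauchy–Schwarz, `|q₀| ≤ 1`, `|σ| = 1`)
  have hq0 : |q.re| ≤ 1 := by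
    have h := Real.abs_le_sqrt (show q.re ^ 2 ≤ 1 by nlinarith [sq_nonneg q.imI, sq_nonneg q.imJ, sq_nonneg q.imK])
    rwa [Real.sqrt_one] at h
  have hσ1 : |σ| = 1 := by rcases hσ with h | h <;> simp [h]
  have hcs : |z 0 * q.imI + z 1 * q.imJ + z 2 * q.imK| ≤
      Real.sqrt ((z 0) ^ 2 + (z 1) ^ 2 + (z 2) ^ 2) * Real.sqrt (q.imI ^ 2 + q.imJ ^ 2 + q.imK ^ 2) := by
    rw [← Real.sqrt_mul (by positivity), ← Real.sqrt_sq_eq_abs]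
    refine Real.sqrt_le_sqrt ?_
    have h := dot3_sq_le (fun a => z a) ![q.imI, q.imJ, q.imK]
    simpa using h
  have hterm : |σ * ri * q.re * (z 0 * q.imI + z 1 * q.imJ + z 2 * q.imK)| ≤ ε := by
    rw [abs_mul, abs_mul, abs_mul, hσ1, one_mul]
    calc |ri| * |q.re| * |z 0 * q.imI + z 1 * q.imJ + z 2 * q.imK|
        ≤ |ri| * 1 * (Real.sqrt ((z 0) ^ 2 + (z 1) ^ 2 + (z 2) ^ 2) * Real.sqrt (q.imI ^ 2 + q.imJ ^ 2 + q.imK ^ 2)) :=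
          mul_le_mul (mul_le_mul_of_nonneg_left hq0 (abs_nonneg _)) hcs (abs_nonneg _) (by positivity)
      _ ≤ ε := by rw [mul_one, ← mul_assoc]; exact hzp
  have h1 : -ε ≤ σ * ri * q.re * (z 0 * q.imI + z 1 * q.imJ + z 2 * q.imK) := (abs_le.1 hterm).1
  have h2 : 3 - 2 * ε ≤ 3 - (q.imI ^ 2 + q.imJ ^ 2 + q.imK ^ 2) + σ * ri * q.re * (z 0 * q.imI + z 1 * q.imJ + z 2 * q.imK) := by linarith
  have h3 := mul_le_mul_of_nonneg_left h2 hNi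
  linarith

/-! ## §2 The frozen part and the total own-curve trace -/

/-- The conjugate central lift in components. [folklore] -/
theorem star_liftQuat_components (σ : ℝ) (z : Fin 3 → ℝ) :
    (star (liftQuat σ z)).re = σ * Real.sqrt (1 - ((z 0) ^ 2 + (z 1) ^ 2 + (z 2) ^ 2)) ∧ (star (liftQuat σ z)).imI = -z 0 ∧
      (star (liftQuat σ z)).imJ = -z 1 ∧ (star (liftQuat σ z)).imK = -z 2 := by
  refine ⟨?_, ?_, ?_, ?_⟩ <;> simp [liftQuat]

/-- ★ **The frozen-anchor trace in components**: `Σ_a Im_a(c̄·(q·u_a)) = 3·Re(c̄·q) = 3·(c̄₀q₀ − c̄_im·p)`; for the conjugate central lift `c̄ = conj(lift σ z)`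
this is `3·(σ√(1−|z|²)·q₀ + z·p)`. [cite: arXiv220412737, §2 (2.4) (p. 10)] -/
theorem frozen_trace_liftQuat (σ : ℝ) (z : Fin 3 → ℝ) (q : ℍ) :
    (star (liftQuat σ z) * (q * ⟨0, 1, 0, 0⟩)).imI + (star (liftQuat σ z) * (q * ⟨0, 0, 1, 0⟩)).imJ +
        (star (liftQuat σ z) * (q * ⟨0, 0, 0, 1⟩)).imK =
      3 * (σ * Real.sqrt (1 - ((z 0) ^ 2 + (z 1) ^ 2 + (z 2) ^ 2)) * q.re + (z 0 * q.imI + z 1 * q.imJ + z 2 * q.imK)) := by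
  rw [← mul_assoc, ← mul_assoc, ← mul_assoc, im_mul_units_sum]
  obtain ⟨hr, hi, hj, hk⟩ := star_liftQuat_components σ z
  simp only [Quaternion.re_mul, hr, hi, hj, hk]
  ring

/-- ★★★ **The total own-curve trace of the anchored profile of a block variable**: frozen part plus base motion,
`Σ_a [Im_a(c̄·q·u_a) + Im_a(E_a·q)] = 3(σ r q₀ + z·p) − Ni(3q₀² + 2|p|² + σ·ri·q₀·(z·p))` (`r = √(1−|z|²)`, `ri = 1/r`): the diagonal entries of the derivative
of `U` at the variable, summed over the three directions.  Summed over a block of `N = 1/Ni` unit variables near the anchor this is `3N − 3 + O(N(r₀²+ρ²))`.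
[cite: CosteEtAl1985] -/
theorem anchored_own_trace (q E₀ E₁ E₂ : ℍ) (z : Fin 3 → ℝ) (σ ri Ni : ℝ)
    (h₀ : E₀.re = -σ * ri * (z 0 * (Ni * q.re) + z 1 * (Ni * q.imK) + z 2 * (Ni * -q.imJ)) ∧
      E₀.imI = -(Ni * q.re) ∧ E₀.imJ = -(Ni * q.imK) ∧ E₀.imK = -(Ni * -q.imJ))
    (h₁ : E₁.re = -σ * ri * (z 0 * (Ni * -q.imK) + z 1 * (Ni * q.re) + z 2 * (Ni * q.imI)) ∧
      E₁.imI = -(Ni * -q.imK) ∧ E₁.imJ = -(Ni * q.re) ∧ E₁.imK = -(Ni * q.imI))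
    (h₂ : E₂.re = -σ * ri * (z 0 * (Ni * q.imJ) + z 1 * (Ni * -q.imI) + z 2 * (Ni * q.re)) ∧
      E₂.imI = -(Ni * q.imJ) ∧ E₂.imJ = -(Ni * -q.imI) ∧ E₂.imK = -(Ni * q.re)) :
    ((star (liftQuat σ z) * (q * ⟨0, 1, 0, 0⟩)).imI + (E₀ * q).imI) + ((star (liftQuat σ z) * (q * ⟨0, 0, 1, 0⟩)).imJ + (E₁ * q).imJ) +
        ((star (liftQuat σ z) * (q * ⟨0, 0, 0, 1⟩)).imK + (E₂ * q).imK) =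
      3 * (σ * Real.sqrt (1 - ((z 0) ^ 2 + (z 1) ^ 2 + (z 2) ^ 2)) * q.re + (z 0 * q.imI + z 1 * q.imJ + z 2 * q.imK)) -
        Ni * (3 * q.re ^ 2 + 2 * (q.imI ^ 2 + q.imJ ^ 2 + q.imK ^ 2) + σ * ri * q.re * (z 0 * q.imI + z 1 * q.imJ + z 2 * q.imK)) := by
  have hf := frozen_trace_liftQuat σ z q
  have hb := base_motion_trace q E₀ E₁ E₂ z σ ri Ni h₀ h₁ h₂
  linarith

/-! ## §3 The chain rule through the central lift (real components) -/

/-- ★ **Chain rule through the central lift, real part**: if the block data move with velocity `dz` and `|z|² < 1` then the real part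
`σ√(1 − |z(s)|²)` of the lift has derivative `−σ·(z·dz)/√(1−|z|²)`; the imaginary parts are the `z_b` themselves. [folklore] -/
theorem hasDerivAt_liftQuat_re (σ : ℝ) {z : ℝ → Fin 3 → ℝ} {dz : Fin 3 → ℝ} {t : ℝ} (hz : ∀ b : Fin 3, HasDerivAt (fun s => z s b) (dz b) t)
    (hlt : (z t 0) ^ 2 + (z t 1) ^ 2 + (z t 2) ^ 2 < 1) :
    HasDerivAt (fun s => (liftQuat σ (z s)).re)
      (-σ * (z t 0 * dz 0 + z t 1 * dz 1 + z t 2 * dz 2) / Real.sqrt (1 - ((z t 0) ^ 2 + (z t 1) ^ 2 + (z t 2) ^ 2))) t := by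
  have hA : HasDerivAt (fun s => 1 - ((z s 0) ^ 2 + (z s 1) ^ 2 + (z s 2) ^ 2))
      (-(2 * z t 0 * dz 0 + 2 * z t 1 * dz 1 + 2 * z t 2 * dz 2)) t := by
    have h := ((((hz 0).pow 2).add ((hz 1).pow 2)).add ((hz 2).pow 2)).const_sub 1
    refine h.congr_deriv ?_
    simp only [Nat.cast_ofNat]
    ring
  have hpos : 1 - ((z t 0) ^ 2 + (z t 1) ^ 2 + (z t 2) ^ 2) ≠ 0 := by linarith
  have hs : Real.sqrt (1 - ((z t 0) ^ 2 + (z t 1) ^ 2 + (z t 2) ^ 2)) ≠ 0 := (Real.sqrt_pos.2 (by linarith)).ne'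
  have hsqrt := (hA.sqrt hpos).const_mul σ
  refine hsqrt.congr_deriv ?_
  field_simp

/-- The imaginary parts of the lift are the block data (so their derivatives are `dz_b`). [folklore] -/
theorem liftQuat_im (σ : ℝ) (z : Fin 3 → ℝ) : (liftQuat σ z).imI = z 0 ∧ (liftQuat σ z).imJ = z 1 ∧ (liftQuat σ z).imK = z 2 :=
  ⟨rfl, rfl, rfl⟩

end Summit.QuantumFields.YangMills.Theorems.VirialFluxGap.FrameDerivative

end
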